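import Summits.MatrixMultiplication.OmegaCensus.CubeStructureChar
import HarnessLib

/-!
# Homometry of the three coset-part pairs of a cube law triple (character core, `c₀ = 0`)

ω-census `pub-omega`, family (b3), seat pub-omega-group gen 6.  Framing: lottery ticket; floor = certified bounds/negative
ranges.  VALUE: a theorem about the group-theoretic method; NOT progress on ω.

Completes the character-level core of the structure theorem for ALL cube shapes `(c,c | d,d | e,e)` in generalized dihedral
groups (`CubeStructureChar.lean` did the step "homometry ⇒ reflected structure"): from the eight unit equations `E1…E8` of the
vertex near-tilings and their conjugates `C1…C8`, at a character where Lemma Ω holds for the three product pairs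
(`CubeRootObstruction`, `3 ∤ |A|`), all three pairs are homometric: `σ₀σ̄₀ = σ₁σ̄₁`, `τ₀τ̄₀ = τ₁τ̄₁`, `υ₀ῡ₀ = υ₁ῡ₁`
(`cube_homometric`).  Proof: the three `2 × 2` viewpoints (`unit_pair_dichotomy`) say that each pair is homometric unless
`|F| = |H| = |K|` for the corresponding triple; a single failing pair is the Eisenstein configuration
(`eisenstein_of_equal_moduli` + Ω); two or three failing pairs are excluded by a short argument on the real norms.
Combined with `cube_structure_of_homometric_charsums` this gives `S₁ = κ_S − S₀`, `T₁ = κ_T − T₀`, `U₁ = κ_U − U₀`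
(`cube_structure_of_charsums`); the TPP wrapper (eight vertex identities) is the remaining mechanical step.
-/

namespace Summit.MatrixMultiplication.OmegaCensus

open Finset

section Core

open ComplexConjugate

/-- Real-norm lemma: three cross relations `A₀B₀ = A₁B₁`, `A₀C₀ = A₁C₁`, `B₀C₀ = B₁C₁` between non-negative reals with
`A₀+A₁, B₀+B₁, C₀+C₁ > 0` force `A₀ = A₁`, `B₀ = B₁`, `C₀ = C₁`. [folklore] -/
theorem norms_equal_of_cross {A₀ A₁ B₀ B₁ C₀ C₁ : ℝ} (hB₀ : 0 ≤ B₀) (hB₁ : 0 ≤ B₁)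
    (hC₀ : 0 ≤ C₀) (hC₁ : 0 ≤ C₁) (hA : 0 < A₀ + A₁) (hB : 0 < B₀ + B₁) (hC : 0 < C₀ + C₁)
    (qU : A₀ * B₀ = A₁ * B₁) (qT : A₀ * C₀ = A₁ * C₁) (qS : B₀ * C₀ = B₁ * C₁) :
    A₀ = A₁ ∧ B₀ = B₁ ∧ C₀ = C₁ := by
  have h1 : A₁ * (B₁ * C₀ - B₀ * C₁) = 0 := by nlinarith [qU, qT, qS]
  have h2 : A₀ * (B₀ * C₁ - B₁ * C₀) = 0 := by nlinarith [qU, qT, qS]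
  have cross : B₁ * C₀ = B₀ * C₁ := by
    rcases mul_eq_zero.1 h1 with h | h
    · rcases mul_eq_zero.1 h2 with h' | h'
      · linarith
      · linarith
    · linarith
  have hBB : B₀ = B₁ := by
    have : (B₀ - B₁) * (C₀ + C₁) = 0 := by nlinarith [qS, cross]
    rcases mul_eq_zero.1 this with h | h
    · linarith
    · linarith
  have hCC : C₀ = C₁ := by
    rcases hBB with rfl
    have hB0 : 0 < B₀ := by linarith
    have : B₀ * (C₀ - C₁) = 0 := by nlinarith [qS]
    rcases mul_eq_zero.1 this with h | h
    · linarith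
    · linarith
  have hAA : A₀ = A₁ := by
    rcases hCC with rfl
    have hC0 : 0 < C₀ := by linarith
    have : (A₀ - A₁) * C₀ = 0 := by nlinarith [qT]
    rcases mul_eq_zero.1 this with h | h
    · linarith
    · linarith
  exact ⟨hAA, hBB, hCC⟩

/-- A single failing pair is impossible: if the `a`- and `b`-pairs are homometric and `|F| = |H|` with `F = a₁b₀ + a₀b₁`,
`H = a₀b₀` (conjugates `G`, `Hc`), Lemma Ω for `(a₁b₀, a₀b₁)` and a vertex equation `F x₀ + H x₁ = −p ≠ 0` give a contradiction.
[folklore] -/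
theorem single_failure_absurd {a₀ a₁ b₀ b₁ ca₀ ca₁ cb₀ cb₁ x₀ x₁ p : ℂ}
    (hca₀ : ca₀ = conj a₀) (hca₁ : ca₁ = conj a₁) (hcb₀ : cb₀ = conj b₀) (hcb₁ : cb₁ = conj b₁)
    (HA : a₀ * ca₀ = a₁ * ca₁) (HB : b₀ * cb₀ = b₁ * cb₁)
    (hFH : (a₁ * b₀ + a₀ * b₁) * (ca₁ * cb₀ + ca₀ * cb₁) = (a₀ * b₀) * (ca₀ * cb₀))
    (hΩ : (a₁ * b₀) ^ 2 + (a₁ * b₀) * (a₀ * b₁) + (a₀ * b₁) ^ 2 = 0 → a₁ * b₀ = 0 ∧ a₀ * b₁ = 0)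
    (hp : p ≠ 0) (hE : (a₁ * b₀ + a₀ * b₁) * x₀ + (a₀ * b₀) * x₁ = -p) : False := by
  have h1 : (a₁ * b₀) * (ca₁ * cb₀) = (a₀ * b₁) * (ca₀ * cb₁) := by
    linear_combination -(b₀ * cb₀) * HA + (a₀ * ca₀) * HB
  have h2 : (a₁ * b₀ + a₀ * b₁) * (ca₁ * cb₀ + ca₀ * cb₁) = (a₀ * b₁) * (ca₀ * cb₁) := by
    linear_combination hFH + (a₀ * ca₀) * HB
  have k := eisenstein_of_equal_moduli (a := a₁ * b₀) (b := a₀ * b₁) (ca := ca₁ * cb₀) (cb := ca₀ * cb₁) h1 h2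
  have hab : a₁ * b₀ = 0 ∧ a₀ * b₁ = 0 := by
    rcases mul_eq_zero.1 k with h | h
    · exact hΩ h
    · have hb : a₀ * b₁ = 0 := by
        have : ca₀ * cb₁ = 0 := pow_eq_zero_iff two_ne_zero |>.1 h
        rw [hca₀, hcb₁, ← map_mul] at this; simpa using this
      have ha : a₁ * b₀ = 0 := by
        have : a₁ * b₀ * (ca₁ * cb₀) = 0 := by rw [h1, hb, zero_mul]
        rw [hca₁, hcb₀, ← map_mul] at this; exact (mul_conj_eq_zero_iff' _).1 this
      exact ⟨ha, hb⟩
  obtain ⟨ha, hb⟩ := hab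
  have hH : a₀ * b₀ = 0 := by
    have : a₀ * b₀ * (ca₀ * cb₀) = 0 := by rw [← hFH, ha, hb]; ring
    rw [hca₀, hcb₀, ← map_mul] at this; exact (mul_conj_eq_zero_iff' _).1 this
  apply hp
  linear_combination hE - x₀ * ha - x₀ * hb - x₁ * hH

/-- **Homometry of the three pairs** from the eight unit equations and their conjugates (`c₀ = 0`). [folklore] -/
theorem cube_homometric (s₀ s₁ t₀ t₁ u₀ u₁ cs₀ cs₁ ct₀ ct₁ cu₀ cu₁ : ℂ)
    (p₁ p₂ p₃ p₄ p₅ p₆ p₇ p₈ p₁' p₂' p₃' p₄' p₅' p₆' p₇' p₈' : ℂ)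
    (hcs₀ : cs₀ = conj s₀) (hcs₁ : cs₁ = conj s₁) (hct₀ : ct₀ = conj t₀) (hct₁ : ct₁ = conj t₁)
    (hcu₀ : cu₀ = conj u₀) (hcu₁ : cu₁ = conj u₁)
    (hp₁ : p₁ * p₁' = 1) (hp₂ : p₂ * p₂' = 1) (hp₃ : p₃ * p₃' = 1) (hp₄ : p₄ * p₄' = 1)
    (hp₅ : p₅ * p₅' = 1) (hp₆ : p₆ * p₆' = 1) (hp₇ : p₇ * p₇' = 1) (hp₈ : p₈ * p₈' = 1)
    (E1 : s₁ * t₀ * u₀ + s₀ * t₁ * u₀ + s₀ * t₀ * u₁ = -p₁) (E2 : s₀ * t₁ * u₁ + s₁ * t₀ * u₁ + s₁ * t₁ * u₀ = -p₂)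
    (E3 : cs₀ * t₀ * u₀ + cs₁ * t₁ * u₀ + cs₁ * t₀ * u₁ = -p₃) (E4 : cs₁ * t₁ * u₁ + cs₀ * t₀ * u₁ + cs₀ * t₁ * u₀ = -p₄)
    (E5 : s₁ * ct₁ * u₀ + s₀ * ct₀ * u₀ + s₀ * ct₁ * u₁ = -p₅) (E6 : s₀ * ct₀ * u₁ + s₁ * ct₁ * u₁ + s₁ * ct₀ * u₀ = -p₆)
    (E7 : s₁ * t₀ * cu₁ + s₀ * t₁ * cu₁ + s₀ * t₀ * cu₀ = -p₇) (E8 : s₀ * t₁ * cu₀ + s₁ * t₀ * cu₀ + s₁ * t₁ * cu₁ = -p₈)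
    (C1 : cs₁ * ct₀ * cu₀ + cs₀ * ct₁ * cu₀ + cs₀ * ct₀ * cu₁ = -p₁') (C2 : cs₀ * ct₁ * cu₁ + cs₁ * ct₀ * cu₁ + cs₁ * ct₁ * cu₀ = -p₂')
    (C3 : s₀ * ct₀ * cu₀ + s₁ * ct₁ * cu₀ + s₁ * ct₀ * cu₁ = -p₃') (C4 : s₁ * ct₁ * cu₁ + s₀ * ct₀ * cu₁ + s₀ * ct₁ * cu₀ = -p₄')
    (C5 : cs₁ * t₁ * cu₀ + cs₀ * t₀ * cu₀ + cs₀ * t₁ * cu₁ = -p₅') (C6 : cs₀ * t₀ * cu₁ + cs₁ * t₁ * cu₁ + cs₁ * t₀ * cu₀ = -p₆')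
    (C7 : cs₁ * ct₀ * u₁ + cs₀ * ct₁ * u₁ + cs₀ * ct₀ * u₀ = -p₇') (C8 : cs₀ * ct₁ * u₀ + cs₁ * ct₀ * u₀ + cs₁ * ct₁ * u₁ = -p₈')
    (hΩst : (s₁ * t₀) ^ 2 + (s₁ * t₀) * (s₀ * t₁) + (s₀ * t₁) ^ 2 = 0 → s₁ * t₀ = 0 ∧ s₀ * t₁ = 0)
    (hΩsu : (s₁ * u₀) ^ 2 + (s₁ * u₀) * (s₀ * u₁) + (s₀ * u₁) ^ 2 = 0 → s₁ * u₀ = 0 ∧ s₀ * u₁ = 0)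
    (hΩtu : (t₁ * u₀) ^ 2 + (t₁ * u₀) * (t₀ * u₁) + (t₀ * u₁) ^ 2 = 0 → t₁ * u₀ = 0 ∧ t₀ * u₁ = 0) :
    s₀ * cs₀ = s₁ * cs₁ ∧ t₀ * ct₀ = t₁ * ct₁ ∧ u₀ * cu₀ = u₁ * cu₁ := by
  have np₁ : p₁ ≠ 0 := fun h => by rw [h, zero_mul] at hp₁; exact zero_ne_one hp₁
  -- the three dichotomies
  have Du := unit_pair_dichotomy (s₁ * t₀ + s₀ * t₁) (s₀ * t₀) (s₁ * t₁) (cs₁ * ct₀ + cs₀ * ct₁) (cs₀ * ct₀) (cs₁ * ct₁)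
    u₀ u₁ cu₀ cu₁ p₁ p₂ p₈' p₇' p₁' p₂' p₈ p₇ hp₁ hp₂ (by rw [mul_comm]; exact hp₈) (by rw [mul_comm]; exact hp₇)
    (by linear_combination E1) (by linear_combination E2) (by linear_combination C8) (by linear_combination C7)
    (by linear_combination C1) (by linear_combination C2) (by linear_combination E8) (by linear_combination E7)
  have Dt := unit_pair_dichotomy (s₁ * u₀ + s₀ * u₁) (s₀ * u₀) (s₁ * u₁) (cs₁ * cu₀ + cs₀ * cu₁) (cs₀ * cu₀) (cs₁ * cu₁)
    t₀ t₁ ct₀ ct₁ p₁ p₂ p₆' p₅' p₁' p₂' p₆ p₅ hp₁ hp₂ (by rw [mul_comm]; exact hp₆) (by rw [mul_comm]; exact hp₅)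
    (by linear_combination E1) (by linear_combination E2) (by linear_combination C6) (by linear_combination C5)
    (by linear_combination C1) (by linear_combination C2) (by linear_combination E6) (by linear_combination E5)
  have Ds := unit_pair_dichotomy (t₁ * u₀ + t₀ * u₁) (t₀ * u₀) (t₁ * u₁) (ct₁ * cu₀ + ct₀ * cu₁) (ct₀ * cu₀) (ct₁ * cu₁)
    s₀ s₁ cs₀ cs₁ p₁ p₂ p₄' p₃' p₁' p₂' p₄ p₃ hp₁ hp₂ (by rw [mul_comm]; exact hp₄) (by rw [mul_comm]; exact hp₃)
    (by linear_combination E1) (by linear_combination E2) (by linear_combination C4) (by linear_combination C3)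
    (by linear_combination C1) (by linear_combination C2) (by linear_combination E4) (by linear_combination E3)
  -- real norms
  set A₀ := Complex.normSq s₀
  set A₁ := Complex.normSq s₁
  set B₀ := Complex.normSq t₀
  set B₁ := Complex.normSq t₁
  set G₀ := Complex.normSq u₀
  set G₁ := Complex.normSq u₁
  have ns₀ : s₀ * cs₀ = (A₀ : ℂ) := by rw [hcs₀, Complex.mul_conj]
  have ns₁ : s₁ * cs₁ = (A₁ : ℂ) := by rw [hcs₁, Complex.mul_conj]
  have nt₀ : t₀ * ct₀ = (B₀ : ℂ) := by rw [hct₀, Complex.mul_conj]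
  have nt₁ : t₁ * ct₁ = (B₁ : ℂ) := by rw [hct₁, Complex.mul_conj]
  have nu₀ : u₀ * cu₀ = (G₀ : ℂ) := by rw [hcu₀, Complex.mul_conj]
  have nu₁ : u₁ * cu₁ = (G₁ : ℂ) := by rw [hcu₁, Complex.mul_conj]
  -- positivity of the pair sums: a vanishing pair kills `E1`
  have posA : 0 < A₀ + A₁ := by
    by_contra h
    have h0 : A₀ = 0 ∧ A₁ = 0 := by
      constructor <;> nlinarith [Complex.normSq_nonneg s₀, Complex.normSq_nonneg s₁]
    have hs0 : s₀ = 0 := Complex.normSq_eq_zero.1 h0.1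
    have hs1 : s₁ = 0 := Complex.normSq_eq_zero.1 h0.2
    apply np₁; have := E1; rw [hs0, hs1] at this; linear_combination this
  have posB : 0 < B₀ + B₁ := by
    by_contra h
    have h0 : B₀ = 0 ∧ B₁ = 0 := by
      constructor <;> nlinarith [Complex.normSq_nonneg t₀, Complex.normSq_nonneg t₁]
    have ht0 : t₀ = 0 := Complex.normSq_eq_zero.1 h0.1
    have ht1 : t₁ = 0 := Complex.normSq_eq_zero.1 h0.2
    apply np₁; have := E1; rw [ht0, ht1] at this; linear_combination this
  have posG : 0 < G₀ + G₁ := by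
    by_contra h
    have h0 : G₀ = 0 ∧ G₁ = 0 := by
      constructor <;> nlinarith [Complex.normSq_nonneg u₀, Complex.normSq_nonneg u₁]
    have hu0 : u₀ = 0 := Complex.normSq_eq_zero.1 h0.1
    have hu1 : u₁ = 0 := Complex.normSq_eq_zero.1 h0.2
    apply np₁; have := E1; rw [hu0, hu1] at this; linear_combination this
  -- translation of the `ℂ` statements into real ones
  have toR : ∀ {x y : ℝ}, ((x : ℂ) = (y : ℂ)) → x = y := fun h => by exact_mod_cast h
  have PS_iff : s₀ * cs₀ = s₁ * cs₁ ↔ A₀ = A₁ := by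
    rw [ns₀, ns₁]; exact ⟨toR, fun h => by rw [h]⟩
  have PT_iff : t₀ * ct₀ = t₁ * ct₁ ↔ B₀ = B₁ := by
    rw [nt₀, nt₁]; exact ⟨toR, fun h => by rw [h]⟩
  have PU_iff : u₀ * cu₀ = u₁ * cu₁ ↔ G₀ = G₁ := by
    rw [nu₀, nu₁]; exact ⟨toR, fun h => by rw [h]⟩
  -- second-branch consequences in real form
  have QU : ¬ (u₀ * cu₀ = u₁ * cu₁) → A₀ * B₀ = A₁ * B₁ ∧
      (s₁ * t₀ + s₀ * t₁) * (cs₁ * ct₀ + cs₀ * ct₁) = (s₀ * t₀) * (cs₀ * ct₀) := by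
    intro h
    rcases Du with h' | ⟨hF, hK⟩
    · exact absurd h' h
    · refine ⟨toR ?_, hF⟩
      have : (s₀ * cs₀) * (t₀ * ct₀) = (s₁ * cs₁) * (t₁ * ct₁) := by linear_combination -hF - hK
      rw [ns₀, ns₁, nt₀, nt₁] at this; exact_mod_cast this
  have QT : ¬ (t₀ * ct₀ = t₁ * ct₁) → A₀ * G₀ = A₁ * G₁ ∧
      (s₁ * u₀ + s₀ * u₁) * (cs₁ * cu₀ + cs₀ * cu₁) = (s₀ * u₀) * (cs₀ * cu₀) := by
    intro h
    rcases Dt with h' | ⟨hF, hK⟩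
    · exact absurd h' h
    · refine ⟨toR ?_, hF⟩
      have : (s₀ * cs₀) * (u₀ * cu₀) = (s₁ * cs₁) * (u₁ * cu₁) := by linear_combination -hF - hK
      rw [ns₀, ns₁, nu₀, nu₁] at this; exact_mod_cast this
  have QS : ¬ (s₀ * cs₀ = s₁ * cs₁) → B₀ * G₀ = B₁ * G₁ ∧
      (t₁ * u₀ + t₀ * u₁) * (ct₁ * cu₀ + ct₀ * cu₁) = (t₀ * u₀) * (ct₀ * cu₀) := by
    intro h
    rcases Ds with h' | ⟨hF, hK⟩
    · exact absurd h' h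
    · refine ⟨toR ?_, hF⟩
      have : (t₀ * ct₀) * (u₀ * cu₀) = (t₁ * ct₁) * (u₁ * cu₁) := by linear_combination -hF - hK
      rw [nt₀, nt₁, nu₀, nu₁] at this; exact_mod_cast this
  have B₀nn := Complex.normSq_nonneg t₀; have B₁nn := Complex.normSq_nonneg t₁
  have G₀nn := Complex.normSq_nonneg u₀; have G₁nn := Complex.normSq_nonneg u₁
  -- case analysis
  by_cases PS : s₀ * cs₀ = s₁ * cs₁ <;> by_cases PT : t₀ * ct₀ = t₁ * ct₁ <;> by_cases PU : u₀ * cu₀ = u₁ * cu₁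
  · exact ⟨PS, PT, PU⟩
  · -- only u fails: Eisenstein for (s₁t₀, s₀t₁) with E1 = F u₀ + H u₁
    exfalso
    obtain ⟨-, hF⟩ := QU PU
    exact single_failure_absurd (x₀ := u₀) (x₁ := u₁) (p := p₁) hcs₀ hcs₁ hct₀ hct₁ PS PT hF hΩst np₁ (by linear_combination E1)
  · exfalso
    obtain ⟨-, hF⟩ := QT PT
    exact single_failure_absurd (x₀ := t₀) (x₁ := t₁) (p := p₁) hcs₀ hcs₁ hcu₀ hcu₁ PS PU hF hΩsu np₁ (by linear_combination E1)
  · -- t and u fail, s homometric: A B₀ = A B₁ with A > 0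
    exfalso
    obtain ⟨q, -⟩ := QU PU
    have hA : A₀ = A₁ := PS_iff.1 PS
    have : A₀ * (B₀ - B₁) = 0 := by rw [hA] at q ⊢; linarith
    rcases mul_eq_zero.1 this with h | h
    · have : A₁ = 0 := by linarith
      linarith
    · exact PT (PT_iff.2 (by linarith))
  · exfalso
    obtain ⟨-, hF⟩ := QS PS
    exact single_failure_absurd (x₀ := s₀) (x₁ := s₁) (p := p₁) hct₀ hct₁ hcu₀ hcu₁ PT PU hF hΩtu np₁ (by linear_combination E1)
  · -- s and u fail, t homometric
    exfalso
    obtain ⟨q, -⟩ := QU PU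
    have hB : B₀ = B₁ := PT_iff.1 PT
    have : (A₀ - A₁) * B₀ = 0 := by rw [hB] at q ⊢; linarith
    rcases mul_eq_zero.1 this with h | h
    · exact PS (PS_iff.2 (by linarith))
    · have : B₁ = 0 := by linarith
      linarith
  · -- s and t fail, u homometric
    exfalso
    obtain ⟨q, -⟩ := QT PT
    have hG : G₀ = G₁ := PU_iff.1 PU
    have : (A₀ - A₁) * G₀ = 0 := by rw [hG] at q ⊢; linarith
    rcases mul_eq_zero.1 this with h | h
    · exact PS (PS_iff.2 (by linarith))
    · have : G₁ = 0 := by linarith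
      linarith
  · -- all three fail: the real-norm lemma forces equality
    exfalso
    obtain ⟨qU, -⟩ := QU PU
    obtain ⟨qT, -⟩ := QT PT
    obtain ⟨qS, -⟩ := QS PS
    obtain ⟨hA, -, -⟩ := norms_equal_of_cross B₀nn B₁nn G₀nn G₁nn posA posB posG qU qT qS
    exact PS (PS_iff.2 hA)

end Core

end Summit.MatrixMultiplication.OmegaCensus
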